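import Mathlib
import Literature.Analysis.FluidPDE.EnergyToolkit
import Summits.NavierStokesRegularity.NavierStokesRegularity.Theorems.PlaneEnergyCeilingPlanarEnergyAPrioriTimeIntegratedEnergy

/-!
# Route PlaneEnergyCeiling · crux `PlanarEnergyAPriori` — THE SIGNED FLUX LEDGER

Helper file for the crux item stmt-NavierStokesRegularity-16855 (`PlanarEnergyAPriori`, route
`PlaneEnergyCeiling`), landed `--supports` that item. The route's TWO-LAYER PLAN:
"PlanarEnergyAPriori ⇐ FluxLedger (|∫F_ℓ dt| ≤ E₀(2 + cνΔt/ℓ²) for the ℓ-smoothed Bernoulli flux,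
provable now from the local energy equality) → FluxConvergenceBudget (the real crux)". This file
proves the FLUX LEDGER.

**Setting.** `(u,p)` a classical solution of unforced Navier–Stokes on `ℝ³ × [0,t]` with
order-(3,2) decay (`‖u‖, ‖Du‖, ‖D²u‖ ≤ C(1+‖x‖)⁻³`, `|p − π₀(s)|, ‖∇p‖ ≤ C(1+‖x‖)⁻²`), energy
`∫|u(s)|² ≤ 2E₀` and dissipation `ν∫∫Σⱼ‖∂ⱼu‖² ≤ E₀` (the Leray–Hopf energy class), and a `C²`
weight `g` of the height with `0 ≤ g ≤ 1`, `|g'| ≤ K₁`, `|g''| ≤ K₂` — a smoothed Heaviside at scale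
`ℓ` has `K₂ ≍ ℓ⁻²`, and then `∫ g'(x₂)(|u|²/2 + p̂)u₂ dx = ∫ g'(c) F(c) dc` is the `ℓ`-SMOOTHED
BERNOULLI FLUX `F_ℓ` through the planes `{x₂ = c}`.

**Statement** (`fluxLedger`). For `0 ≤ s₁ ≤ s₂ ≤ t`:
`|∫_{s₁}^{s₂} ∫ g'(x₂)(|u|²/2 + (p − π₀))u₂ dx ds| ≤ E₀ (2 + ν K₂ (s₂ − s₁))`.

**Proof.** The weighted energy identity at each time (seat 3, `weightedEnergyIdentity`),
`∫ g·2⟪u, acc⟫ = ν∫g''|u|² − 2ν∫gΣ‖∂ⱼu‖² + 2∫g'(|u|²/2+p̂)u₂`, integrated over `(s₁,s₂)`, where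
the left side is `∫g|u(s₂)|² − ∫g|u(s₁)|²` (`timeIntegratedWeightedEnergy`, landed); the three
energy-class bounds `0 ≤ ∫g|u(s)|² ≤ 2E₀`, `|ν∫∫g''|u|²| ≤ 2νK₂ΔsE₀`, `0 ≤ 2ν∫∫gΣ‖∂ⱼu‖² ≤ 2E₀`
finish. So the SIGNED time integrals of the smoothed flux through every plane are bounded a priori
by the energy: planar energy can only grow by OSCILLATION of the flux convergence in time and
across the parabolic scale — the content left to `stub_fluxConvergenceBudget`.
Folklore (Caffarelli–Kohn–Nirenberg 1982 §2, local energy equality tested with a smoothed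
Heaviside; route file WHY THIS LINE).
-/

noncomputable section

-- single-conjunct summit: `Summit.<Summit>.<Problem>` repeats the name by the D-0017 layout
set_option linter.dupNamespace false

namespace Summit.NavierStokesRegularity.NavierStokesRegularity.Theorems.PlanarEnergyAPriori

open MeasureTheory Set Filter Topology Function WithLp
open scoped ENNReal RealInnerProductSpace Laplacian
open Literature.Analysis.FluidPDE
open Summit.NavierStokesRegularity.NavierStokesRegularity.Theorems.PlaneEnergyCeilingSlabEnergyIdentity
open Summit.NavierStokesRegularity.NavierStokesRegularity.Theorems.PlanarEnergyAPriori.SlabLaw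

/-! ### Integrability in time of the weighted space integrals -/

section TimeIntegrable

variable {ν t : ℝ} {u : ℝ → EuclideanSpace ℝ (Fin 3) → EuclideanSpace ℝ (Fin 3)} {p : ℝ → EuclideanSpace ℝ (Fin 3) → ℝ}

/-- **A jointly continuous density with a uniform integrable majorant has time-integrable space
integrals**: if `G` is continuous on `[a,b] × ℝ³` and `‖G(s,x)‖ ≤ B(x)` there with `B`
integrable, then `s ↦ ∫ G(s,x) dx` is integrable on `(a,b)` and
`|∫_{(a,b)}∫ G| ≤ (b − a) ∫ B` (`a ≤ b`). -/
theorem integrableOn_integral_of_dominated {G : ℝ × EuclideanSpace ℝ (Fin 3) → ℝ} {a b : ℝ} (hab : a ≤ b)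
    (hG : ContinuousOn G (Icc a b ×ˢ univ)) {B : EuclideanSpace ℝ (Fin 3) → ℝ} (hB : Integrable B)
    (hdom : ∀ s ∈ Icc a b, ∀ x, ‖G (s, x)‖ ≤ B x) :
    IntegrableOn (fun s => ∫ x, G (s, x)) (Ioo a b) ∧
      ‖∫ s in Ioo a b, ∫ x, G (s, x)‖ ≤ (b - a) * ∫ x, B x := by
  have hBnn : ∀ x, 0 ≤ B x := fun x => (norm_nonneg _).trans (hdom a ⟨le_rfl, hab⟩ x)
  have hslice : ∀ s ∈ Ioo a b, ∫⁻ x, ‖G (s, x)‖ₑ ≤ ENNReal.ofReal (∫ x, B x) := by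
    intro s hs
    rw [ofReal_integral_eq_lintegral_ofReal hB (ae_of_all _ hBnn)]
    refine lintegral_mono fun x => ?_
    rw [← ofReal_norm]
    exact ENNReal.ofReal_le_ofReal (hdom s (Ioo_subset_Icc_self hs) x)
  have hlin : ∫⁻ s in Ioo a b, ∫⁻ x, ‖G (s, x)‖ₑ ≤ ENNReal.ofReal (b - a) * ENNReal.ofReal (∫ x, B x) := by
    calc ∫⁻ s in Ioo a b, ∫⁻ x, ‖G (s, x)‖ₑ ≤ ∫⁻ _ in Ioo a b, ENNReal.ofReal (∫ x, B x) :=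
          setLIntegral_mono' measurableSet_Ioo hslice
      _ = ENNReal.ofReal (b - a) * ENNReal.ofReal (∫ x, B x) := by
          rw [setLIntegral_const, Real.volume_Ioo, mul_comm]
  have hfin : ∫⁻ s in Ioo a b, ∫⁻ x, ‖G (s, x)‖ₑ < ∞ :=
    hlin.trans_lt (ENNReal.mul_lt_top ENNReal.ofReal_lt_top ENNReal.ofReal_lt_top)
  have hprod := integrable_prod_of_continuousOn_of_lintegral hG hfin
  refine ⟨hprod.integral_prod_left, ?_⟩
  have h := norm_integral_integral_le_of_lintegral_le
    (ENNReal.mul_ne_top ENNReal.ofReal_ne_top ENNReal.ofReal_ne_top) hlin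
  rwa [ENNReal.toReal_mul, ENNReal.toReal_ofReal (by linarith), ENNReal.toReal_ofReal
    (integral_nonneg hBnn)] at h

end TimeIntegrable

/-! ### The flux ledger -/

section Ledger

variable {ν t : ℝ} {u : ℝ → EuclideanSpace ℝ (Fin 3) → EuclideanSpace ℝ (Fin 3)} {p : ℝ → EuclideanSpace ℝ (Fin 3) → ℝ}

/-- The gradient and the Fréchet derivative of a scalar function have the same norm
(Riesz isometry). -/
theorem norm_fderiv_eq_norm_gradient (f : EuclideanSpace ℝ (Fin 3) → ℝ) (x : EuclideanSpace ℝ (Fin 3)) :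
    ‖fderiv ℝ f x‖ = ‖gradient f x‖ := by
  rw [gradient, LinearIsometryEquiv.norm_map]

/-- Subtracting a constant does not change the gradient. -/
theorem gradient_sub_const (f : EuclideanSpace ℝ (Fin 3) → ℝ) (c : ℝ) (x : EuclideanSpace ℝ (Fin 3)) :
    gradient (fun y => f y - c) x = gradient f x := by
  simp only [gradient, fderiv_sub_const]

/-- Subtracting a constant does not change the Fréchet derivative. -/
theorem fderiv_sub_const' (f : EuclideanSpace ℝ (Fin 3) → ℝ) (c : ℝ) (x : EuclideanSpace ℝ (Fin 3)) :
    fderiv ℝ (fun y => f y - c) x = fderiv ℝ f x := by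
  simp only [fderiv_sub_const]

/-- **THE SIGNED FLUX LEDGER** (conditional on the weighted energy identity `hWI`, the registered
helper `weightedEnergyIdentity` of the line). Let `(u,p)` be a classical solution of unforced
Navier–Stokes on `ℝ³ × [0,t]` (`ν > 0`, `t > 0`) with order-(3,2) decay on `[0,t]` (pressure
normalised by `π₀(s)`), with energies `∫|u(s)|² ≤ 2E₀` and dissipation
`ν∫₀ᵗ∫Σⱼ‖∂ⱼu‖² ≤ E₀`. Then for every `C²` weight `g` of the height with `0 ≤ g ≤ 1`,
`|g'| ≤ K₁`, `|g''| ≤ K₂` and all `0 ≤ s₁ ≤ s₂ ≤ t`: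

  `|∫_{(s₁,s₂)} ∫ g'(x₂) (|u|²/2 + (p − π₀(s))) u₂ dx ds| ≤ E₀ (2 + ν K₂ (s₂ − s₁))`.

With `g` a Heaviside smoothed at scale `ℓ` (`K₂ ≍ ℓ⁻²`) the inner integral is the `ℓ`-smoothed
Bernoulli flux through the planes `{x₂ = c}`: its SIGNED time integrals are bounded a priori by
the energy (route file: `|∫F_ℓ dt| ≤ E₀(2 + cνΔt/ℓ²)`). [folklore] -/
theorem fluxLedger_of_weightedEnergyIdentity
    (hWI : ∀ (ν : ℝ) (u : EuclideanSpace ℝ (Fin 3) → EuclideanSpace ℝ (Fin 3)) (p : EuclideanSpace ℝ (Fin 3) → ℝ) (C : ℝ), ContDiff ℝ 2 u → ContDiff ℝ 1 p → Literature.Analysis.FluidPDE.VectorCalculus.IsDivFree u → (∀ x, ‖u x‖ ≤ C * (1 + ‖x‖) ^ (-(3 : ℝ))) → (∀ x, ‖fderiv ℝ u x‖ ≤ C * (1 + ‖x‖) ^ (-(3 : ℝ))) → (∀ x, ‖iteratedFDeriv ℝ 2 u x‖ ≤ C * (1 + ‖x‖) ^ (-(3 : ℝ))) → (∀ x, ‖p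 x‖ ≤ C * (1 + ‖x‖) ^ (-(2 : ℝ))) → (∀ x, ‖fderiv ℝ p x‖ ≤ C * (1 + ‖x‖) ^ (-(2 : ℝ))) → ∀ (g : ℝ → ℝ) (K : ℝ), ContDiff ℝ 2 g → (∀ z, |g z| ≤ K) → (∀ z, |deriv g z| ≤ K) → (∀ z, |deriv (deriv g) z| ≤ K) → ∫ x, g (x 2) * (2 * inner ℝ (u x) (ν • Laplacian.laplacian u x - Literature.Analysis.FluidPDE.convect u u x - gradient p x)) = ν * (∫ x, deriv (deriv g) (x 2) * ‖u x‖ ^ 2) - 2 * ν * (∫ x, g (x 2) * ∑ j : Fin 3, ‖fderiv ℝ u x (EuclideanSpace.single j 1)‖ ^ 2) + 2 * (∫ x, deriv g (x 2) * ((‖u x‖ ^ 2 / 2 + p x) * u x 2)))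
    (hν : 0 < ν) (ht : 0 < t) (hcl : IsClassicalNSSolutionOn (Icc 0 t) ν 0 u p)
    {C : ℝ} {π₀ : ℝ → ℝ}
    (h0 : ∀ s ∈ Icc 0 t, ∀ x, ‖u s x‖ ≤ C * (1 + ‖x‖) ^ (-(3 : ℝ)))
    (h1 : ∀ s ∈ Icc 0 t, ∀ x, ‖fderiv ℝ (u s) x‖ ≤ C * (1 + ‖x‖) ^ (-(3 : ℝ)))
    (h2 : ∀ s ∈ Icc 0 t, ∀ x, ‖iteratedFDeriv ℝ 2 (u s) x‖ ≤ C * (1 + ‖x‖) ^ (-(3 : ℝ)))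
    (k0 : ∀ s ∈ Icc 0 t, ∀ x, |p s x - π₀ s| ≤ C * (1 + ‖x‖) ^ (-(2 : ℝ)))
    (k1 : ∀ s ∈ Icc 0 t, ∀ x, ‖gradient (p s) x‖ ≤ C * (1 + ‖x‖) ^ (-(2 : ℝ)))
    {E₀ : ℝ} (hE : ∀ s ∈ Icc 0 t, ∫ x, ‖u s x‖ ^ 2 ≤ 2 * E₀)
    (hDiss : ν * ∫ s in Ioo 0 t, ∫ x, ∑ j : Fin 3, ‖fderiv ℝ (u s) x (EuclideanSpace.single j 1)‖ ^ 2 ≤ E₀)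
    {g : ℝ → ℝ} (hg : ContDiff ℝ 2 g) {K₁ K₂ : ℝ} (hg01 : ∀ z, 0 ≤ g z ∧ g z ≤ 1)
    (hK₁ : ∀ z, |deriv g z| ≤ K₁) (hK₂ : ∀ z, |deriv (deriv g) z| ≤ K₂)
    {s₁ s₂ : ℝ} (hs₁ : 0 ≤ s₁) (hs : s₁ ≤ s₂) (hs₂ : s₂ ≤ t) :
    |∫ s in Ioo s₁ s₂, ∫ x, deriv g (x 2) * ((‖u s x‖ ^ 2 / 2 + (p s x - π₀ s)) * u s x 2)| ≤
      E₀ * (2 + ν * K₂ * (s₂ - s₁)) := by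
  /- constants and the weight -/
  have hs₁I : s₁ ∈ Icc 0 t := ⟨hs₁, hs.trans hs₂⟩
  have hs₂I : s₂ ∈ Icc 0 t := ⟨hs₁.trans hs, hs₂⟩
  have hIcc : Icc s₁ s₂ ⊆ Icc 0 t := Icc_subset_Icc hs₁ hs₂
  have hC : 0 ≤ C := nonneg_of_norm_le_rpow (h0 s₁ hs₁I)
  have hE0 : 0 ≤ E₀ := by
    have h := hE s₁ hs₁I
    have h' : 0 ≤ ∫ x, ‖u s₁ x‖ ^ 2 := integral_nonneg fun x => sq_nonneg _
    linarith
  have hK₂0 : 0 ≤ K₂ := (abs_nonneg _).trans (hK₂ 0)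
  set K : ℝ := max 1 (max K₁ K₂) with hKdef
  have hgK : ∀ z, |g z| ≤ K := fun z => by
    rw [abs_of_nonneg (hg01 z).1]; exact (hg01 z).2.trans (le_max_left _ _)
  have hg'K : ∀ z, |deriv g z| ≤ K := fun z =>
    (hK₁ z).trans ((le_max_left _ _).trans (le_max_right _ _))
  have hg''K : ∀ z, |deriv (deriv g) z| ≤ K := fun z =>
    (hK₂ z).trans ((le_max_right _ _).trans (le_max_right _ _))
  have hgc : Continuous g := hg.continuous
  have hg''c : Continuous (deriv (deriv g)) := by
    have := hg.continuous_iteratedDeriv 2 le_rfl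
    rwa [iteratedDeriv_succ, iteratedDeriv_one] at this
  /- smoothness of the solution -/
  have hU : UniqueDiffOn ℝ (Icc 0 t) := uniqueDiffOn_Icc ht
  have hsm := hcl.smooth_velocity
  have hu_c : ContinuousOn (uncurry u) (Icc 0 t ×ˢ univ) := hsm.continuousOn
  have hdt_c : ContinuousOn (uncurry (timeDerivWithin (Icc 0 t) u)) (Icc 0 t ×ˢ univ) :=
    (hsm.timeDerivWithin hU).continuousOn
  have hD_c : ∀ j : Fin 3, ContinuousOn (uncurry fun s x => fderiv ℝ (u s) x (EuclideanSpace.single j 1))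
      (Icc 0 t ×ˢ univ) := fun j => (hsm.fderiv_slice_apply hU (EuclideanSpace.single j 1)).continuousOn
  have hw_c : ∀ {h : ℝ → ℝ}, Continuous h →
      ContinuousOn (fun z : ℝ × EuclideanSpace ℝ (Fin 3) => h (z.2 2)) (Icc 0 t ×ˢ univ) := fun hh =>
    ((continuous_weight hh).comp continuous_snd).continuousOn
  /- the per-time weighted energy identity, with the momentum equation inserted -/
  have hid : ∀ s ∈ Icc 0 t,
      ∫ x, g (x 2) * (2 * ⟪timeDerivWithin (Icc 0 t) u s x, u s x⟫) =
        ν * (∫ x, deriv (deriv g) (x 2) * ‖u s x‖ ^ 2) -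
        2 * ν * (∫ x, g (x 2) * ∑ j : Fin 3, ‖fderiv ℝ (u s) x (EuclideanSpace.single j 1)‖ ^ 2) +
        2 * (∫ x, deriv g (x 2) * ((‖u s x‖ ^ 2 / 2 + (p s x - π₀ s)) * u s x 2)) := by
    intro s hs'
    have hu2 : ContDiff ℝ 2 (u s) := (hcl.contDiff_velocity hs').of_le (by norm_cast)
    have hp1 : ContDiff ℝ 1 (fun x => p s x - π₀ s) :=
      ((hcl.contDiff_pressure hs').of_le (by exact_mod_cast le_top)).sub contDiff_const
    have k0' : ∀ x, ‖p s x - π₀ s‖ ≤ C * (1 + ‖x‖) ^ (-(2 : ℝ)) := fun x => by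
      rw [Real.norm_eq_abs]; exact k0 s hs' x
    have k1' : ∀ x, ‖fderiv ℝ (fun y => p s y - π₀ s) x‖ ≤ C * (1 + ‖x‖) ^ (-(2 : ℝ)) := fun x => by
      rw [fderiv_sub_const', norm_fderiv_eq_norm_gradient]; exact k1 s hs' x
    have h := hWI ν (u s) (fun x => p s x - π₀ s) C hu2 hp1 (hcl.divFree s hs') (h0 s hs') (h1 s hs')
      (h2 s hs') k0' k1' g K hg hgK hg'K hg''K
    simp_rw [gradient_sub_const] at h
    rw [← h]
    refine integral_congr_ae (ae_of_all _ fun x => ?_)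
    dsimp only
    rw [timeDerivWithin_eq_acc hcl hs', real_inner_comm]
  /- the three densities as functions on `ℝ × ℝ³`, their continuity and uniform majorants -/
  set FL : ℝ × EuclideanSpace ℝ (Fin 3) → ℝ := fun z =>
    g (z.2 2) * (2 * ⟪timeDerivWithin (Icc 0 t) u z.1 z.2, u z.1 z.2⟫) with hFL
  set FA : ℝ × EuclideanSpace ℝ (Fin 3) → ℝ := fun z => deriv (deriv g) (z.2 2) * ‖u z.1 z.2‖ ^ 2 with hFA
  set FD : ℝ × EuclideanSpace ℝ (Fin 3) → ℝ := fun z =>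
    g (z.2 2) * ∑ j : Fin 3, ‖fderiv ℝ (u z.1) z.2 (EuclideanSpace.single j 1)‖ ^ 2 with hFD
  set FDp : ℝ × EuclideanSpace ℝ (Fin 3) → ℝ := fun z =>
    ∑ j : Fin 3, ‖fderiv ℝ (u z.1) z.2 (EuclideanSpace.single j 1)‖ ^ 2 with hFDp
  have hFDpc : ContinuousOn FDp (Icc 0 t ×ˢ univ) :=
    continuousOn_finsetSum _ fun j _ => (hD_c j).norm.pow 2
  have hFLc : ContinuousOn FL (Icc s₁ s₂ ×ˢ univ) :=
    ((hw_c hgc).mul (continuousOn_const.mul (hdt_c.inner hu_c))).mono (prod_mono hIcc Subset.rfl)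
  have hFAc : ContinuousOn FA (Icc s₁ s₂ ×ˢ univ) :=
    ((hw_c hg''c).mul (hu_c.norm.pow 2)).mono (prod_mono hIcc Subset.rfl)
  have hFDc : ContinuousOn FD (Icc s₁ s₂ ×ˢ univ) := ((hw_c hgc).mul hFDpc).mono (prod_mono hIcc Subset.rfl)
  -- majorants
  have hr5 : (Module.finrank ℝ (EuclideanSpace ℝ (Fin 3)) : ℝ) < 5 := by
    rw [finrank_euclideanSpace, Fintype.card_fin]; norm_num
  have hr6 : (Module.finrank ℝ (EuclideanSpace ℝ (Fin 3)) : ℝ) < 6 := by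
    rw [finrank_euclideanSpace, Fintype.card_fin]; norm_num
  set A5 : ℝ := 2 * K * C * (3 * ν * C + C ^ 2 + C) with hA5
  have hBL : Integrable fun x : EuclideanSpace ℝ (Fin 3) => A5 * (1 + ‖x‖) ^ (-(5 : ℝ)) :=
    (integrable_one_add_norm hr5).const_mul A5
  have hBA : Integrable fun x : EuclideanSpace ℝ (Fin 3) => K * C ^ 2 * (1 + ‖x‖) ^ (-(6 : ℝ)) :=
    (integrable_one_add_norm hr6).const_mul _
  have hBD : Integrable fun x : EuclideanSpace ℝ (Fin 3) => 3 * C ^ 2 * (1 + ‖x‖) ^ (-(6 : ℝ)) :=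
    (integrable_one_add_norm hr6).const_mul _
  have hdomL : ∀ s ∈ Icc s₁ s₂, ∀ x, ‖FL (s, x)‖ ≤ A5 * (1 + ‖x‖) ^ (-(5 : ℝ)) := by
    intro s hs' x
    have hsI := hIcc hs'
    simp only [hFL]
    rw [timeDerivWithin_eq_acc hcl hsI x, hA5]
    exact norm_weight_mul_two_inner_acc_le hν.le hC (h0 s hsI x) (h1 s hsI x) (h2 s hsI x) (k1 s hsI x) hgK
  have hsumD : ∀ s ∈ Icc 0 t, ∀ x,
      ∑ j : Fin 3, ‖fderiv ℝ (u s) x (EuclideanSpace.single j 1)‖ ^ 2 ≤ 3 * C ^ 2 * (1 + ‖x‖) ^ (-(6 : ℝ)) := by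
    intro s hs' x
    calc ∑ j : Fin 3, ‖fderiv ℝ (u s) x (EuclideanSpace.single j 1)‖ ^ 2
        ≤ ∑ _j : Fin 3, C ^ 2 * (1 + ‖x‖) ^ (-(6 : ℝ)) :=
          Finset.sum_le_sum fun j _ => norm_sq_fderiv_le_weight (h1 s hs' x) j
      _ = 3 * C ^ 2 * (1 + ‖x‖) ^ (-(6 : ℝ)) := by simp [Finset.sum_const]; ring
  have hsumD0 : ∀ s x, 0 ≤ ∑ j : Fin 3, ‖fderiv ℝ (u s) x (EuclideanSpace.single j 1)‖ ^ 2 :=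
    fun s x => Finset.sum_nonneg fun j _ => sq_nonneg _
  have hdomA : ∀ s ∈ Icc s₁ s₂, ∀ x, ‖FA (s, x)‖ ≤ K * C ^ 2 * (1 + ‖x‖) ^ (-(6 : ℝ)) := by
    intro s hs' x
    simp only [hFA, norm_mul, Real.norm_eq_abs]
    rw [abs_of_nonneg (sq_nonneg ‖u s x‖), mul_assoc]
    exact mul_le_mul (hg''K _) (norm_sq_le_weight (h0 s (hIcc hs') x)) (sq_nonneg _)
      ((abs_nonneg _).trans (hg''K 0))
  have hdomD : ∀ s ∈ Icc s₁ s₂, ∀ x, ‖FD (s, x)‖ ≤ 3 * C ^ 2 * (1 + ‖x‖) ^ (-(6 : ℝ)) := by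
    intro s hs' x
    simp only [hFD, norm_mul, Real.norm_eq_abs]
    rw [abs_of_nonneg (hg01 _).1, abs_of_nonneg (hsumD0 s x)]
    calc g (x 2) * ∑ j : Fin 3, ‖fderiv ℝ (u s) x (EuclideanSpace.single j 1)‖ ^ 2
        ≤ 1 * ∑ j : Fin 3, ‖fderiv ℝ (u s) x (EuclideanSpace.single j 1)‖ ^ 2 :=
          mul_le_mul_of_nonneg_right (hg01 _).2 (hsumD0 s x)
      _ ≤ 3 * C ^ 2 * (1 + ‖x‖) ^ (-(6 : ℝ)) := by rw [one_mul]; exact hsumD s (hIcc hs') x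
  have hdomD' : ∀ s ∈ Icc 0 t, ∀ x, ‖FDp (s, x)‖ ≤ 3 * C ^ 2 * (1 + ‖x‖) ^ (-(6 : ℝ)) := by
    intro s hs' x
    simp only [hFDp, Real.norm_eq_abs]
    rw [abs_of_nonneg (hsumD0 s x)]
    exact hsumD s hs' x
  /- time-integrability of the space integrals -/
  obtain ⟨hIL, -⟩ := integrableOn_integral_of_dominated hs hFLc hBL hdomL
  obtain ⟨hIA, -⟩ := integrableOn_integral_of_dominated hs hFAc hBA hdomA
  obtain ⟨hID, -⟩ := integrableOn_integral_of_dominated hs hFDc hBD hdomD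
  obtain ⟨hID', -⟩ := integrableOn_integral_of_dominated ht.le hFDpc hBD hdomD'
  simp only [hFL, hFA, hFD, hFDp] at hIL hIA hID hID'
  /- the left side: the time-integrated weighted energy -/
  have hLHS : ∫ s in Ioo s₁ s₂, ∫ x, g (x 2) * (2 * ⟪timeDerivWithin (Icc 0 t) u s x, u s x⟫) =
      (∫ x, g (x 2) * ‖u s₂ x‖ ^ 2) - ∫ x, g (x 2) * ‖u s₁ x‖ ^ 2 := by
    rw [← integral_Ioo_integral_weight_mul_two_inner_acc hν.le ht hcl h0 h1 h2 k1 hgc hgK hs₁ hs hs₂]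
    refine setIntegral_congr_fun measurableSet_Ioo fun s hs' => ?_
    have hsI : s ∈ Icc 0 t := hIcc (Ioo_subset_Icc_self hs')
    simp_rw [timeDerivWithin_eq_acc hcl hsI]
  /- abbreviations for the time integrals -/
  set IA : ℝ := ∫ s in Ioo s₁ s₂, ∫ x, deriv (deriv g) (x 2) * ‖u s x‖ ^ 2 with hIAdef
  set ID : ℝ := ∫ s in Ioo s₁ s₂, ∫ x, g (x 2) * ∑ j : Fin 3, ‖fderiv ℝ (u s) x (EuclideanSpace.single j 1)‖ ^ 2
    with hIDdef
  set IX : ℝ := ∫ s in Ioo s₁ s₂, ∫ x, deriv g (x 2) * ((‖u s x‖ ^ 2 / 2 + (p s x - π₀ s)) * u s x 2) with hIXdef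
  set W₁ : ℝ := ∫ x, g (x 2) * ‖u s₁ x‖ ^ 2 with hW₁
  set W₂ : ℝ := ∫ x, g (x 2) * ‖u s₂ x‖ ^ 2 with hW₂
  /- integrability of the flux term from the identity, and the integrated identity -/
  have hIXint : IntegrableOn (fun s => ∫ x, deriv g (x 2) * ((‖u s x‖ ^ 2 / 2 + (p s x - π₀ s)) * u s x 2))
      (Ioo s₁ s₂) := by
    have hcomb : IntegrableOn (fun s => 2⁻¹ * ((∫ x, g (x 2) * (2 * ⟪timeDerivWithin (Icc 0 t) u s x, u s x⟫)) -
        ν * (∫ x, deriv (deriv g) (x 2) * ‖u s x‖ ^ 2) +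
        2 * ν * (∫ x, g (x 2) * ∑ j : Fin 3, ‖fderiv ℝ (u s) x (EuclideanSpace.single j 1)‖ ^ 2)))
        (Ioo s₁ s₂) :=
      ((hIL.sub (hIA.const_mul ν)).add (hID.const_mul (2 * ν))).const_mul 2⁻¹
    refine hcomb.congr_fun (fun s hs' => ?_) measurableSet_Ioo
    have hsI : s ∈ Icc 0 t := hIcc (Ioo_subset_Icc_self hs')
    dsimp only
    rw [hid s hsI]
    ring
  have hint_id : W₂ - W₁ = ν * IA - 2 * ν * ID + 2 * IX := by
    rw [← hLHS]
    have : ∫ s in Ioo s₁ s₂, ∫ x, g (x 2) * (2 * ⟪timeDerivWithin (Icc 0 t) u s x, u s x⟫) =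
        ∫ s in Ioo s₁ s₂, (ν * (∫ x, deriv (deriv g) (x 2) * ‖u s x‖ ^ 2) -
          2 * ν * (∫ x, g (x 2) * ∑ j : Fin 3, ‖fderiv ℝ (u s) x (EuclideanSpace.single j 1)‖ ^ 2) +
          2 * (∫ x, deriv g (x 2) * ((‖u s x‖ ^ 2 / 2 + (p s x - π₀ s)) * u s x 2))) :=
      setIntegral_congr_fun measurableSet_Ioo fun s hs' => hid s (hIcc (Ioo_subset_Icc_self hs'))
    have hF1 : Integrable (fun s => ν * (∫ x, deriv (deriv g) (x 2) * ‖u s x‖ ^ 2) -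
        2 * ν * (∫ x, g (x 2) * ∑ j : Fin 3, ‖fderiv ℝ (u s) x (EuclideanSpace.single j 1)‖ ^ 2))
        (volume.restrict (Ioo s₁ s₂)) := (hIA.const_mul ν).sub (hID.const_mul (2 * ν))
    have hF2 : Integrable (fun s => 2 * (∫ x, deriv g (x 2) * ((‖u s x‖ ^ 2 / 2 + (p s x - π₀ s)) * u s x 2)))
        (volume.restrict (Ioo s₁ s₂)) := hIXint.const_mul 2
    have hF3 : Integrable (fun s => ν * (∫ x, deriv (deriv g) (x 2) * ‖u s x‖ ^ 2))
        (volume.restrict (Ioo s₁ s₂)) := hIA.const_mul ν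
    have hF4 : Integrable (fun s => 2 * ν * (∫ x, g (x 2) * ∑ j : Fin 3, ‖fderiv ℝ (u s) x (EuclideanSpace.single j 1)‖ ^ 2))
        (volume.restrict (Ioo s₁ s₂)) := hID.const_mul (2 * ν)
    rw [this, integral_add hF1 hF2, integral_sub hF3 hF4, integral_const_mul, integral_const_mul,
      integral_const_mul]
  /- energy-class bounds -/
  have hnormsq_int : ∀ s ∈ Icc 0 t, Integrable fun x => ‖u s x‖ ^ 2 := fun s hs' =>
    integrable_norm_sq (hcl.contDiff_velocity hs').continuous (h0 s hs')
  -- end energies: 0 ≤ Wᵢ ≤ 2E₀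
  have hW : ∀ s ∈ Icc 0 t, 0 ≤ ∫ x, g (x 2) * ‖u s x‖ ^ 2 ∧ ∫ x, g (x 2) * ‖u s x‖ ^ 2 ≤ 2 * E₀ := by
    intro s hs'
    refine ⟨integral_nonneg fun x => mul_nonneg (hg01 _).1 (sq_nonneg _), ?_⟩
    calc ∫ x, g (x 2) * ‖u s x‖ ^ 2 ≤ ∫ x, ‖u s x‖ ^ 2 := by
          refine integral_mono (integrable_weight_mul (hnormsq_int s hs') hgc hgK) (hnormsq_int s hs')
            fun x => ?_
          exact mul_le_of_le_one_left (sq_nonneg _) (hg01 _).2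
      _ ≤ 2 * E₀ := hE s hs'
  -- the g'' term: |IA| ≤ 2K₂E₀Δs
  have hIA_bd : |IA| ≤ 2 * K₂ * E₀ * (s₂ - s₁) := by
    have hper : ∀ s ∈ Ioo s₁ s₂, ‖∫ x, deriv (deriv g) (x 2) * ‖u s x‖ ^ 2‖ ≤ 2 * K₂ * E₀ := by
      intro s hs'
      have hsI : s ∈ Icc 0 t := hIcc (Ioo_subset_Icc_self hs')
      calc ‖∫ x, deriv (deriv g) (x 2) * ‖u s x‖ ^ 2‖ ≤ ∫ x, K₂ * ‖u s x‖ ^ 2 := by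
            refine norm_integral_le_of_norm_le ((hnormsq_int s hsI).const_mul K₂)
              (ae_of_all _ fun x => ?_)
            rw [norm_mul, Real.norm_eq_abs, Real.norm_of_nonneg (sq_nonneg _)]
            exact mul_le_mul_of_nonneg_right (hK₂ _) (sq_nonneg _)
        _ = K₂ * ∫ x, ‖u s x‖ ^ 2 := integral_const_mul _ _
        _ ≤ K₂ * (2 * E₀) := mul_le_mul_of_nonneg_left (hE s hsI) hK₂0
        _ = 2 * K₂ * E₀ := by ring
    have h := norm_setIntegral_le_of_norm_le_const (measure_Ioo_lt_top : volume (Ioo s₁ s₂) < ∞) hper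
    rw [Real.norm_eq_abs, Measure.real, Real.volume_Ioo, ENNReal.toReal_ofReal (by linarith)] at h
    calc |IA| ≤ 2 * K₂ * E₀ * (s₂ - s₁) := h
      _ = 2 * K₂ * E₀ * (s₂ - s₁) := rfl
  -- the dissipation term: 0 ≤ ID ≤ E₀/ν
  have hID0 : 0 ≤ ID := by
    refine setIntegral_nonneg measurableSet_Ioo fun s _ => integral_nonneg fun x => ?_
    exact mul_nonneg (hg01 _).1 (hsumD0 s x)
  have hID_bd : ν * ID ≤ E₀ := by
    have h1' : ID ≤ ∫ s in Ioo s₁ s₂, ∫ x, ∑ j : Fin 3, ‖fderiv ℝ (u s) x (EuclideanSpace.single j 1)‖ ^ 2 := by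
      refine setIntegral_mono_on hID (hID'.mono_set (Ioo_subset_Ioo hs₁ hs₂)) measurableSet_Ioo fun s hs' => ?_
      have hsI : s ∈ Icc 0 t := hIcc (Ioo_subset_Icc_self hs')
      have hi1 : Integrable fun x => ∑ j : Fin 3, ‖fderiv ℝ (u s) x (EuclideanSpace.single j 1)‖ ^ 2 :=
        integrable_of_norm_le_rpow (f := fun x => ∑ j : Fin 3, ‖fderiv ℝ (u s) x (EuclideanSpace.single j 1)‖ ^ 2)
          (continuous_finsetSum _ fun j _ =>
            ((((hcl.contDiff_velocity hsI).continuous_fderiv (by simp)).clm_apply continuous_const).norm.pow 2))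
          (by norm_num : (3 : ℝ) < 6) (hdomD' s hsI)
      refine integral_mono (integrable_weight_mul hi1 hgc hgK) hi1 fun x => ?_
      exact mul_le_of_le_one_left (hsumD0 s x) (hg01 _).2
    have h2' : ∫ s in Ioo s₁ s₂, ∫ x, ∑ j : Fin 3, ‖fderiv ℝ (u s) x (EuclideanSpace.single j 1)‖ ^ 2 ≤
        ∫ s in Ioo 0 t, ∫ x, ∑ j : Fin 3, ‖fderiv ℝ (u s) x (EuclideanSpace.single j 1)‖ ^ 2 :=
      setIntegral_mono_set hID' (ae_of_all _ fun s => integral_nonneg fun x => hsumD0 s x)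
        (ae_of_all _ (Ioo_subset_Ioo hs₁ hs₂))
    nlinarith [mul_le_mul_of_nonneg_left (h1'.trans h2') hν.le]
  /- conclusion -/
  have hW₁b := hW s₁ hs₁I
  have hW₂b := hW s₂ hs₂I
  rw [← hW₁, ← hW₂] at *
  have hIA' := abs_le.1 hIA_bd
  rw [abs_le]
  constructor
  · nlinarith [hIA'.1, hIA'.2, hW₁b.1, hW₁b.2, hW₂b.1, hW₂b.2, hID0, hID_bd, hν.le, hK₂0, hE0,
      mul_nonneg hν.le hK₂0]
  · nlinarith [hIA'.1, hIA'.2, hW₁b.1, hW₁b.2, hW₂b.1, hW₂b.2, hID0, hID_bd, hν.le, hK₂0, hE0,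
      mul_nonneg hν.le hK₂0]

/-- **The signed flux ledger, registered form** (sub-goal `fluxLedger_conditional` of
stmt-NavierStokesRegularity-16855): the weighted energy identity (registered helper
`weightedEnergyIdentity` of the line, hypothesis) implies the ledger
`|∫_{(s₁,s₂)}∫ g'(x₂)(|u|²/2 + (p − π₀))u₂| ≤ E₀(2 + νK₂(s₂ − s₁))` along every classical solution
on `[0,t]` with order-(3,2) decay in the energy class, for every `C²` weight `0 ≤ g ≤ 1` of the
height with `|g'| ≤ K₁`, `|g''| ≤ K₂`. [folklore] -/
theorem fluxLedger_conditional : (∀ (ν : ℝ) (u : EuclideanSpace ℝ (Fin 3) → EuclideanSpace ℝ (Fin 3)) (p : EuclideanSpace ℝ (Fin 3) → ℝ) (C : ℝ), ContDiff ℝ 2 u → ContDiff ℝ 1 p → Literature.Analysis.FluidPDE.VectorCalculus.IsDivFree u → (∀ x, ‖u x‖ ≤ C * (1 + ‖x‖) ^ (-(3 : ℝ))) → (∀ x, ‖fderiv ℝ u x‖ ≤ C * (1 + ‖x‖) ^ (-(3 : ℝ))) → (∀ x, ‖iteratedFDeriv ℝ 2 u x‖ ≤ C * (1 + ‖x‖)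 ^ (-(3 : ℝ))) → (∀ x, ‖p x‖ ≤ C * (1 + ‖x‖) ^ (-(2 : ℝ))) → (∀ x, ‖fderiv ℝ p x‖ ≤ C * (1 + ‖x‖) ^ (-(2 : ℝ))) → ∀ (g : ℝ → ℝ) (K : ℝ), ContDiff ℝ 2 g → (∀ z, |g z| ≤ K) → (∀ z, |deriv g z| ≤ K) → (∀ z, |deriv (deriv g) z| ≤ K) → ∫ x, g (x 2) * (2 * inner ℝ (u x) (ν • Laplacian.laplacian u x - Literature.Analysis.FluidPDE.convect u u x - gradient p x)) = ν * (∫ x, deriv (deriv g) (x 2) * ‖u x‖ ^ 2) - 2 * ν * (∫ x, g (x 2) * ∑ j : Fin 3, ‖fderiv ℝ u x (EuclideanSpace.single j 1)‖ ^ 2) + 2 * (∫ x, deriv g (x 2) * ((‖u x‖ ^ 2 / 2 + p x) * u x 2))) → ∀ (ν t : ℝ), 0 < ν → 0 < t → ∀ (u : ℝ → EuclideanSpace ℝ (Fin 3) → EuclideanSpace ℝ (Fin 3)) (p : ℝ → EuclideanSpace ℝ (Fin 3) → ℝ), Literature.Analysis.FluidPDE.IsClassicalNSSolutionOn (Set.Icc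 0 t) ν 0 u p → ∀ (C : ℝ) (π₀ : ℝ → ℝ), (∀ s ∈ Set.Icc 0 t, ∀ x, ‖u s x‖ ≤ C * (1 + ‖x‖) ^ (-(3 : ℝ))) → (∀ s ∈ Set.Icc 0 t, ∀ x, ‖fderiv ℝ (u s) x‖ ≤ C * (1 + ‖x‖) ^ (-(3 : ℝ))) → (∀ s ∈ Set.Icc 0 t, ∀ x, ‖iteratedFDeriv ℝ 2 (u s) x‖ ≤ C * (1 + ‖x‖) ^ (-(3 : ℝ))) → (∀ s ∈ Set.Icc 0 t, ∀ x, |p s x - π₀ s| ≤ C * (1 + ‖x‖) ^ (-(2 : ℝ))) → (∀ s ∈ Set.Icc 0 t, ∀ x, ‖gradient (p s) x‖ ≤ C * (1 + ‖x‖) ^ (-(2 : ℝ))) → ∀ (E₀ : ℝ), (∀ s ∈ Set.Icc 0 t, ∫ x, ‖u s x‖ ^ 2 ≤ 2 * E₀) → ν * (∫ s in Set.Ioo 0 t, ∫ x, ∑ j : Fin 3, ‖fderiv ℝ (u s) x (EuclideanSpace.single j 1)‖ ^ 2) ≤ E₀ → ∀ (g : ℝ → ℝ) (K₁ K₂ :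 ℝ), ContDiff ℝ 2 g → (∀ z, 0 ≤ g z ∧ g z ≤ 1) → (∀ z, |deriv g z| ≤ K₁) → (∀ z, |deriv (deriv g) z| ≤ K₂) → ∀ (s₁ s₂ : ℝ), 0 ≤ s₁ → s₁ ≤ s₂ → s₂ ≤ t → |∫ s in Set.Ioo s₁ s₂, ∫ x, deriv g (x 2) * ((‖u s x‖ ^ 2 / 2 + (p s x - π₀ s)) * u s x 2)| ≤ E₀ * (2 + ν * K₂ * (s₂ - s₁)) :=
  fun hWI _ _ hν ht _ _ hcl _ _ h0 h1 h2 k0 k1 _ hE hDiss _ _ _ hg hg01 hK₁ hK₂ _ _ hs₁ hs hs₂ =>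
    fluxLedger_of_weightedEnergyIdentity hWI hν ht hcl h0 h1 h2 k0 k1 hE hDiss hg hg01 hK₁ hK₂ hs₁ hs hs₂

end Ledger

end Summit.NavierStokesRegularity.NavierStokesRegularity.Theorems.PlanarEnergyAPriori

end
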